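import Literature.NumberTheory.GaloisCohomology.BrauerSumInvCyclicClass
import HarnessLib

/-!
# The cyclic reciprocity law with its archimedean term

`sum_localInvariantMap_localization_cupProduct_δ₀_eq_zero` (Tate, Cassels–Fröhlich VII §10) computes
`∑_{v ∈ S} inv_v (loc_v (κₙ(b) ∪ ψ)) = 0` under the hypothesis that the Artin map `ψ_{L|K}` kills the
archimedean idèle of `b`.  Here the archimedean term is KEPT: for any `γ ∈ Γ_K` lifting
`ψ_{L|K}((b)_∞) ∈ Gal(L/K)`,

  `∑_{v ∈ S} inv_v (loc_v (κₙ(b) ∪ ψ)) = -ψ(γ)`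

(`sum_localInvariantMap_localization_cupProduct_δ₀_eq_neg_apply`) — the finite places see minus the
archimedean Artin symbol.  This is the form needed for the `2`-primary part of the reciprocity law
over number fields with real places, where `ψ_{L|K}((b)_∞)` is the product of the complex
conjugations at the real places `w` with `b <_w 0` and `L_w = ℂ`.  Same proof as the tree's theorem
(Artin reciprocity for the principal idèle of `b`, local evaluation at unramified places, local norms
at ramified ones).  Theorems only (D-0026).

## References

* J. Tate, *Global class field theory*, Ch. VII of Cassels–Fröhlich (1967), §10. [CasselsFrohlichANT1967]
* J. Neukirch, *Algebraic Number Theory* (1999), Ch. VI §5 (5.6)–(5.8). [NeukirchANT1999]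
-/

noncomputable section

open CategoryTheory Function NumberField IsDedekindDomain Field ValuativeRel
open scoped NumberField

namespace Literature.NumberTheory.GaloisCohomology

open _root_.ContinuousCohomology
open Literature.NumberTheory.GaloisRepresentations
open Literature.NumberTheory.GaloisRepresentations.DiscreteGaloisModule
open Literature.NumberTheory.GaloisRepresentations.LocalWeilDatum
open Literature.NumberTheory.GaloisRepresentations.IsNonarchimedeanLocalField
open Literature.NumberTheory.NumberFields
open Literature.AnabelianGeometry.AbsoluteAnabelian
open Literature.AnabelianGeometry.AbsoluteAnabelian.Prop121vii

variable {K : Type} [Field K] [NumberField K] {n : ℕ} [NeZero n]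
  (L : IntermediateField K (AlgebraicClosure K)) [FiniteDimensional K L] [IsAbelianGalois K L]
  [NumberField L]

/-- **`∑_{v ∈ S} inv_v (loc_v (κₙ(b) ∪ ψ)) = -ψ(γ)` for `γ` lifting the archimedean Artin symbol
`ψ_{L|K}((b)_∞)`** (Tate, Cassels–Fröhlich VII §10, with the archimedean term kept): hypotheses as in
`sum_localInvariantMap_localization_cupProduct_δ₀_eq_zero` except `hinf`, which is replaced by the
lift `γ`. [cite: CasselsFrohlichANT1967, Ch. VII §10] [cite: NeukirchANT1999, Ch. VI §5 Prop. (5.6), Cor. (5.8)] -/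
theorem sum_localInvariantMap_localization_cupProduct_δ₀_eq_neg_apply
    (ψ : CyclicCharacter (absoluteGaloisGroup K) n) (hker : ψ.ker = galFixing K L) (b : Kˣ)
    (γ : absoluteGaloisGroup K)
    (hγ : absRestrictNormalHom L γ = artinIdeleMap L artinReciprocity_character_holds
      (infiniteIdeles K (globalToInfiniteUnits K b)))
    (hram : ∀ v : HeightOneSpectrum (𝓞 K),
      (∃ σ ∈ absInertia (v.adicCompletion K), ψ (absGaloisRestrict K (v.adicCompletion K) σ) ≠ 0) →
      haveI : CompactSpace (absoluteGaloisGroup K) := absoluteGaloisGroup_compactSpace K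
      galoisCohomology.localization (mu K n) (Sum.inr v) 2 (((mu K n).tateDualPairing n).cupProduct
        ((isSES_kummer K n (NeZero.pos n)).δ₀ (baseUnitsInvariant K (b : K) b.ne_zero))
        (oneCocycleClass _ (scalarCocycle ψ))) = 0)
    (S : Finset (HeightOneSpectrum (𝓞 K)))
    (hS : ∀ v ∉ S,
      haveI : CompactSpace (absoluteGaloisGroup K) := absoluteGaloisGroup_compactSpace K
      localInvariantMap K n v (galoisCohomology.localization (mu K n) (Sum.inr v) 2
        (((mu K n).tateDualPairing n).cupProduct
          ((isSES_kummer K n (NeZero.pos n)).δ₀ (baseUnitsInvariant K (b : K) b.ne_zero))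
          (oneCocycleClass _ (scalarCocycle ψ)))) = 0) :
    haveI : CompactSpace (absoluteGaloisGroup K) := absoluteGaloisGroup_compactSpace K
    ∑ v ∈ S, localInvariantMap K n v (galoisCohomology.localization (mu K n) (Sum.inr v) 2
        (((mu K n).tateDualPairing n).cupProduct
          ((isSES_kummer K n (NeZero.pos n)).δ₀ (baseUnitsInvariant K (b : K) b.ne_zero))
          (oneCocycleClass _ (scalarCocycle ψ)))) = -ψ γ := by
  classical
  haveI : CompactSpace (absoluteGaloisGroup K) := absoluteGaloisGroup_compactSpace K
  -- `n = 1`: nothing to prove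
  rcases Nat.lt_or_ge 1 n with hn1 | hn1
  swap
  · have hn : n = 1 := le_antisymm hn1 (NeZero.pos n)
    subst hn
    exact Subsingleton.elim _ _
  set hR := artinReciprocity_character_holds
  set A := artinIdeleMap L hR with hA
  set c := ((mu K n).tateDualPairing n).cupProduct
    ((isSES_kummer K n (NeZero.pos n)).δ₀ (baseUnitsInvariant K (b : K) b.ne_zero))
    (oneCocycleClass _ (scalarCocycle ψ)) with hc
  -- the character `ψ̄` of `G(L|K)` with `ψ̄ (γ|_L) = ψ γ`
  have hle : (absRestrictNormalHom L).ker ≤ ψ.toMonoidHom.ker := by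
    intro γ hγ
    rw [MonoidHom.mem_ker, absRestrictNormalHom_eq_one_iff] at hγ
    have hγ' : γ ∈ ψ.ker := by rw [hker]; exact hγ
    rw [CyclicCharacter.mem_ker] at hγ'
    rw [MonoidHom.mem_ker]
    change Multiplicative.ofAdd (ψ γ) = 1
    rw [hγ', ofAdd_zero]
  set ψbar : (L ≃ₐ[K] L) →* Multiplicative (ZMod n) :=
    (absRestrictNormalHom L).liftOfSurjective (absRestrictNormalHom_surjective L) ⟨ψ.toMonoidHom, hle⟩
    with hψbar
  have hψbar_apply : ∀ γ : absoluteGaloisGroup K,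
      ψbar (absRestrictNormalHom L γ) = Multiplicative.ofAdd (ψ γ) := fun γ =>
    (absRestrictNormalHom L).liftOfRightInverse_comp_apply _ _ _ γ
  -- the local terms `t_v = ψ̄ (ψ_{L|K} ⟨b⟩_v)`, read additively
  set t : HeightOneSpectrum (𝓞 K) → ZMod n :=
    fun v => Multiplicative.toAdd (ψbar (A (localUnits v (globalToLocalUnits v b)))) with ht
  -- Claim A: `t_v = inv_v (loc_v c)` at every finite place
  have hA_loc : ∀ v : HeightOneSpectrum (𝓞 K),
      t v = localInvariantMap K n v (galoisCohomology.localization (mu K n) (Sum.inr v) 2 c) := by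
    intro v
    haveI : CharZero (v.adicCompletion K) := charZero_adicCompletion v
    by_cases hunr : ∀ σ ∈ absInertia (v.adicCompletion K), ψ (absGaloisRestrict K (v.adicCompletion K) σ) = 0
    · -- unramified: both sides are `-ψ(res w)` for `Art_v w = b`
      obtain ⟨ψE, hIE, hFE, -, -⟩ := exists_normalizedCharacter (v.adicCompletion K) n hn1
      obtain ⟨f, hψf, hf⟩ := exists_apply_absGaloisRestrict_eq_mul (v.adicCompletion K) ψ hunr ψE hIE hFE
      have hinv := localInvariantMap_localization_cupProduct_δ₀ v ψ ψE hIE hFE hψf (b : K) b.ne_zero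
      rw [hc, hinv]
      obtain ⟨w, hw⟩ := (isLocalArtinMap_canonicalArtin_holds (v.adicCompletion K)).isOpenQuotientMap_artin.surjective
        (globalToLocalUnits v b)
      have hord : ord (v.adicCompletion K) (algebraMap K (v.adicCompletion K) (b : K)) = -WeilGroup.deg w := by
        rw [← val_globalToLocalUnits, ← hw, ord_canonicalArtin]
      rw [ht]
      change Multiplicative.toAdd (ψbar (A (localUnits v (globalToLocalUnits v b)))) = _
      rw [← hw, hA, artinIdeleMap_localUnits_canonicalArtin_eq_inv L w, map_inv, hψbar_apply, toAdd_inv,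
        toAdd_ofAdd, apply_absGaloisRestrict_toAbsGalois_eq v ψ hunr hf w, hord, Int.cast_neg]
      ring
    · -- ramified: the class vanishes at `v`, `b` is a local norm, `ψ_{L|K}(⟨b⟩_v) = 1`
      push Not at hunr
      have h0 := hram v hunr
      have hres : resMu K (v.adicCompletion K) n 2 c = 0 := by
        rw [← cohomologyMap_muLocalIso_localization, h0]; exact map_zero _
      have hnorm := mem_range_norm_compositum_of_resMu_cupProduct_δ₀_eq_zero v L ψ hker b hres
      have h1 : A (localUnits v (globalToLocalUnits v b)) = 1 :=
        (artinIdeleMap_localUnits_eq_one_iff_mem_range_norm L _).mpr hnorm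
      rw [ht]
      change Multiplicative.toAdd (ψbar (A (localUnits v (globalToLocalUnits v b)))) = _
      rw [h1, map_one, toAdd_one, h0, map_zero]
  -- Claim B: `∑_{v ∈ S'} t_v = 0` for `S' ⊇ S` large
  obtain ⟨S₀, hS₀⟩ := exists_map_unitIdelesOutside_le K (normClassGroup K L) (isOpen_normClassGroup' L)
  set T := (finite_setOf_valued_ne_one b).toFinset with hT
  set S' := S ∪ S₀ ∪ T with hS'
  have hTS' : ∀ v ∉ S', Valued.v (algebraMap K (v.adicCompletion K) (b : K)) = 1 := by
    intro v hv
    by_contra h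
    exact hv (Finset.mem_union_right _ ((finite_setOf_valued_ne_one b).mem_toFinset.mpr h))
  obtain ⟨u, hu, hdec⟩ := principalIdele_mem_mul_unitIdelesOutside b S' hTS'
  have hAu : A u = 1 := by
    have hu' : u ∈ unitIdelesOutside K S₀ :=
      unitIdelesOutside_antitone (Finset.subset_union_right.trans Finset.subset_union_left) hu
    have hmem : QuotientGroup.mk' (principalIdeles K) u ∈ normClassGroup K L :=
      hS₀ (Subgroup.mem_map_of_mem _ hu')
    rw [← ker_artinClassMap_eq L, MonoidHom.mem_ker, QuotientGroup.mk'_apply, artinClassMap_mk] at hmem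
    exact hmem
  -- the composite character `Φ = ψ̄ ∘ ψ_{L|K} : 𝕀_K → ℤ/n` (commutative target)
  set Φ : ideleGroup K →* Multiplicative (ZMod n) := ψbar.comp A with hΦ
  have hprod : ∏ v ∈ S', Φ (localUnits v (globalToLocalUnits v b)) = Multiplicative.ofAdd (-ψ γ) := by
    have h : Φ (principalIdele K b) = 1 := by
      rw [hΦ, MonoidHom.comp_apply, hA, artinIdeleMap_eq_one_of_mem_principalIdeles L hR (principalIdele_mem b),
        map_one]
    rw [hdec, map_mul, map_mul, map_prod] at h
    have hΦu : Φ u = 1 := by rw [hΦ, MonoidHom.comp_apply, hAu, map_one]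
    have hΦinf : Φ (infiniteIdeles K (globalToInfiniteUnits K b)) = Multiplicative.ofAdd (ψ γ) := by
      rw [hΦ, MonoidHom.comp_apply, ← hγ, hψbar_apply]
    rw [hΦu, mul_one, hΦinf, ← eq_inv_iff_mul_eq_one, ← ofAdd_neg] at h
    exact h
  have hsum' : ∑ v ∈ S', t v = -ψ γ := by
    rw [ht]
    change ∑ v ∈ S', Multiplicative.toAdd (Φ (localUnits v (globalToLocalUnits v b))) = -ψ γ
    rw [← toAdd_prod, hprod, toAdd_ofAdd]
  -- assemble: the terms off `S` vanish
  have hSS' : S ⊆ S' := Finset.subset_union_left.trans Finset.subset_union_left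
  rw [Finset.sum_subset hSS' (fun v _ hv => hS v hv), ← hsum']
  exact Finset.sum_congr rfl fun v _ => (hA_loc v).symm


end Literature.NumberTheory.GaloisCohomology

end
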